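import Mathlib.Analysis.InnerProductSpace.Completion
import Mathlib.Analysis.InnerProductSpace.l2Space
import Mathlib.Analysis.InnerProductSpace.Adjoint
import Mathlib.Analysis.Normed.Operator.Extend
import HarnessLib

/-!
# The Hilbert completion of a positive definite Hermitian form and the extension of bounded operators to it

Topic `NumberTheory/Automorphic`; namespace `Literature.NumberTheory.Automorphic.IsPosDefHerm` (dot notation on the hypothesis
`hB : IsPosDefHerm B`); sequel `InfUnitaryHilbertCompletionKAction` (the unitary `K`-action, the `IsInfUnitary` reading).  Cell `hodgecm-mathlib`, F0∕P3, ROAD-GLOB (`F0/P3/A-p14/ROAD-A6-UnitaryGlobalizationU21.A-p14g24.md`)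
to the letter A6 #92 `HasUnitaryGlobalizationOfInfUnitary` [KnappVogan1995, Thm. 0.6 (a)] at `U(2,1)`: brick **G0**.  Definitions WITH BODIES
+ their API, all proved; no named fact, no `instance` declaration, no notation, no `sorry`.

THE MATHEMATICS ([KnappVogan1995, Introduction (0.5)–Thm. 0.6; BorelWallach2000, 0 §2.5]; Harish-Chandra's first step towards the unitary
globalization of an infinitesimally unitary `(𝔤, K)`-module).  Let `V` be a complex vector space with a POSITIVE DEFINITE HERMITIAN form `B`
(conjugate-linear in the first variable, `B : V →ₗ⋆[ℂ] V →ₗ[ℂ] ℂ`, `B x y = conj (B y x)`, `re B x x > 0` for `x ≠ 0` — the form clauses of ★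
`Liu2021.LemD2.IsInfUnitary`).  Then `(V, B)` is a pre-Hilbert space; we realise its completion as the Mathlib Hilbert space
`E := ℓ²(I, ℂ)` over the index set `I` of a Hilbert basis of the abstract completion (so that `E` carries ONLY Mathlib instances and `V`
NONE), with a dense isometric linear embedding `emb : V →ₗ[ℂ] E`, `⟪emb x, emb y⟫ = B x y`.  A linear operator `T` on `V` which is
bounded for `B` (`‖emb (T x)‖ ≤ C ‖emb x‖`) extends uniquely to a bounded operator `extend T` on `E` with `extend T (emb x) = emb (T x)`
(Mathlib `LinearMap.extendOfNorm`), functorially, and a `B`-isometric surjective `T` extends to a UNITARY; a `B`-skew operator is skew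
after `emb` (§5).  The sequel builds from this the unitary strongly continuous `K`-action on `E`.

HONEST LABEL: brick G0 of the road; closes no registered stub.  HC_CM is proved only modulo the 2 remaining named inputs (hLiu418, h413) until rung 0 closes.

## Mathlib ∕ tree search
Mathlib: `InnerProductSpace.Core`∕`.ofCore`, `UniformSpace.Completion` (inner product space, complete; `inner_coe`), `exists_hilbertBasis`,
`HilbertBasis.repr`, `LinearMap.extendOfNorm`∕`extendOfNorm_eq`∕`extendOfNorm_unique`∕`norm_extendOfNorm_apply_le`, `DenseRange.equalizer`,
`ContinuousLinearMap.norm_map_iff_adjoint_comp_self`, `Unitary.mem_iff`.  Tree: the `letI` idiom of ★ `GKModulesUnitaryIrreducibleSubmodule`.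
Dedup: `rg "IsPosDefHerm|InfUnitaryHilbert|extendOfNorm"` over `Literature/` — no hits.

## References
* A. W. Knapp, D. A. Vogan, *Cohomological Induction and Unitary Representations* (1995), Introduction (0.5), Thm. 0.6 [KnappVogan1995].
* A. Borel, N. Wallach, *Continuous Cohomology, Discrete Subgroups, and Representations of Reductive Groups*, 2nd ed. (2000), 0 §2.5 [BorelWallach2000].
* Harish-Chandra, *Representations of a semisimple Lie group on a Banach space. I*, Trans. AMS 75 (1953), §9 [HarishChandra1953].
-/

set_option autoImplicit false

noncomputable section

open scoped InnerProductSpace ComplexConjugate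
open Filter Topology

namespace Literature.NumberTheory.Automorphic

universe u

variable {V : Type u} [AddCommGroup V] [Module ℂ V]

/-! ## §1 Positive definite Hermitian forms and the pre-Hilbert structure -/

/-- **`B` is a positive definite Hermitian form** (conjugate-linear in the first variable): `B x y = conj (B y x)` and `re B x x > 0` for
`x ≠ 0` — the two form clauses of ★ `Liu2021.LemD2.IsInfUnitary` [KnappVogan1995, (0.5)]. [cite: KnappVogan1995, Introduction (0.5)] -/
structure IsPosDefHerm (B : V →ₗ⋆[ℂ] V →ₗ[ℂ] ℂ) : Prop where
  /-- Hermitian symmetry. -/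
  herm : ∀ x y : V, B x y = conj (B y x)
  /-- positivity on non-zero vectors. -/
  pos : ∀ x : V, x ≠ 0 → 0 < (B x x).re

namespace IsPosDefHerm

variable {B : V →ₗ⋆[ℂ] V →ₗ[ℂ] ℂ} (hB : IsPosDefHerm B)
include hB

/-- `re B x x ≥ 0` for every `x`. [cite: KnappVogan1995, Introduction (0.5)] -/
theorem re_nonneg (x : V) : 0 ≤ (B x x).re := by
  by_cases hx : x = 0
  · subst hx; simp
  · exact (hB.pos x hx).le

/-- `B x x = 0` only for `x = 0`. [cite: KnappVogan1995, Introduction (0.5)] -/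
theorem eq_zero_of_self_eq_zero {x : V} (h : B x x = 0) : x = 0 := by
  by_contra hx
  have := hB.pos x hx
  rw [h] at this
  simp at this

/-- The Mathlib `InnerProductSpace.Core` of `(V, B)`: `⟪x, y⟫ := B x y`. [cite: KnappVogan1995, Introduction (0.5)] -/
@[reducible] def core : InnerProductSpace.Core ℂ V where
  inner x y := B x y
  conj_inner_symm x y := (hB.herm x y).symm
  re_inner_nonneg x := hB.re_nonneg x
  add_left x y z := by simp [map_add]
  smul_left x y r := by simp [LinearMap.map_smulₛₗ]
  definite x hx := hB.eq_zero_of_self_eq_zero hx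

/-- The normed group structure of `(V, B)` (`‖x‖ = √(re B x x)`), as a TERM (never an instance). [cite: KnappVogan1995, Introduction (0.5)] -/
@[reducible] def nacg : NormedAddCommGroup V :=
  @InnerProductSpace.Core.toNormedAddCommGroup ℂ V _ _ _ hB.core

/-- The inner product space structure of `(V, B)` over `nacg`, as a TERM. [cite: KnappVogan1995, Introduction (0.5)] -/
@[reducible] def ips : @InnerProductSpace ℂ V _ hB.nacg.toSeminormedAddCommGroup :=
  @InnerProductSpace.ofCore ℂ V _ _ _ hB.core.toCore

/-- With the local structures, `⟪x, y⟫ = B x y` (definitional). [cite: KnappVogan1995, Introduction (0.5)] -/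
theorem inner_eq (x y : V) : @inner ℂ V hB.ips.toInner x y = B x y := rfl

/-- With the local structures, `‖x‖² = re B x x`. [cite: KnappVogan1995, Introduction (0.5)] -/
theorem norm_sq_eq (x : V) : @norm V hB.nacg.toNorm x ^ 2 = (B x x).re := by
  letI := hB.nacg; letI := hB.ips
  rw [@norm_sq_eq_re_inner ℂ]; rfl

/-! ## §2 The Hilbert space `E = ℓ²(I, ℂ)` and the dense isometric embedding -/

/-- The abstract completion of `(V, B)` (auxiliary; carries the local structures). [cite: BorelWallach2000, 0 §2.5] -/
abbrev Hat : Type u := @UniformSpace.Completion V hB.nacg.toMetricSpace.toPseudoMetricSpace.toUniformSpace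

/-- Its normed group structure (term). [cite: BorelWallach2000, 0 §2.5] -/
@[reducible] def hatNacg : NormedAddCommGroup hB.Hat := by
  letI := hB.nacg; letI := hB.ips
  exact (inferInstance : NormedAddCommGroup (UniformSpace.Completion V))

/-- Its inner product space structure (term). [cite: BorelWallach2000, 0 §2.5] -/
@[reducible] def hatIps : @InnerProductSpace ℂ hB.Hat _ hB.hatNacg.toSeminormedAddCommGroup := by
  letI := hB.nacg; letI := hB.ips
  exact (inferInstance : InnerProductSpace ℂ (UniformSpace.Completion V))

/-- Its completeness. [cite: BorelWallach2000, 0 §2.5] -/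
theorem hat_completeSpace : @CompleteSpace hB.Hat hB.hatNacg.toMetricSpace.toPseudoMetricSpace.toUniformSpace := by
  letI := hB.nacg; letI := hB.ips
  exact (inferInstance : CompleteSpace (UniformSpace.Completion V))

/-- **The index set `I` of a Hilbert basis of the completion** (Mathlib `exists_hilbertBasis`). [cite: BorelWallach2000, 0 §2.5] -/
def Idx : Set hB.Hat := by
  letI := hB.hatNacg; letI := hB.hatIps; haveI := hB.hat_completeSpace
  exact (exists_hilbertBasis ℂ hB.Hat).choose

/-- The chosen Hilbert basis of the completion, indexed by `Idx`. [cite: BorelWallach2000, 0 §2.5] -/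
def hatBasis : @HilbertBasis hB.Idx ℂ _ hB.Hat hB.hatNacg hB.hatIps := by
  letI := hB.hatNacg; letI := hB.hatIps; haveI := hB.hat_completeSpace
  exact (exists_hilbertBasis ℂ hB.Hat).choose_spec.choose

/-- **THE HILBERT SPACE `E := ℓ²(I, ℂ)` of `(V, B)`** — a Mathlib type with Mathlib instances only, in the universe of `V`.
[cite: KnappVogan1995, Introduction Thm. 0.6] [cite: BorelWallach2000, 0 §2.5] -/
abbrev E : Type u := lp (fun _ : hB.Idx => ℂ) 2

/-- **The dense isometric embedding `emb : V →ₗ[ℂ] E`** (`V → V̂ → ℓ²(I)`, the second arrow the coordinate isometry of the Hilbert basis).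
[cite: BorelWallach2000, 0 §2.5] -/
def emb : V →ₗ[ℂ] hB.E := by
  letI := hB.nacg; letI := hB.ips; haveI := hB.hat_completeSpace
  exact (hB.hatBasis.repr.toLinearEquiv : hB.Hat →ₗ[ℂ] hB.E) ∘ₗ
    ((UniformSpace.Completion.toComplL : V →L[ℂ] UniformSpace.Completion V) : V →ₗ[ℂ] UniformSpace.Completion V)

/-- **`emb` is isometric for `B`: `⟪emb x, emb y⟫ = B x y`.** [cite: KnappVogan1995, Introduction (0.5)] -/
theorem inner_emb_emb (x y : V) : ⟪hB.emb x, hB.emb y⟫_ℂ = B x y := by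
  letI := hB.nacg; letI := hB.ips; haveI := hB.hat_completeSpace
  change ⟪hB.hatBasis.repr (x : UniformSpace.Completion V), hB.hatBasis.repr (y : UniformSpace.Completion V)⟫_ℂ = _
  rw [LinearIsometryEquiv.inner_map_map, UniformSpace.Completion.inner_coe]
  rfl

/-- `‖emb x‖² = re B x x`. [cite: KnappVogan1995, Introduction (0.5)] -/
theorem norm_emb_sq (x : V) : ‖hB.emb x‖ ^ 2 = (B x x).re := by
  rw [@norm_sq_eq_re_inner ℂ, hB.inner_emb_emb]
  rfl

/-- `‖emb x‖ = √(re B x x)`. [cite: KnappVogan1995, Introduction (0.5)] -/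
theorem norm_emb (x : V) : ‖hB.emb x‖ = Real.sqrt ((B x x).re) := by
  rw [← hB.norm_emb_sq, Real.sqrt_sq (norm_nonneg _)]

/-- **Cauchy–Schwarz for `B`**: `‖B x y‖ ≤ ‖emb x‖ · ‖emb y‖`. [cite: KnappVogan1995, Introduction (0.5)] -/
theorem norm_apply_le (x y : V) : ‖B x y‖ ≤ ‖hB.emb x‖ * ‖hB.emb y‖ := by
  rw [← hB.inner_emb_emb]; exact norm_inner_le_norm _ _

/-- `emb` is injective. [cite: KnappVogan1995, Introduction (0.5)] -/
theorem emb_injective : Function.Injective hB.emb := by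
  intro x y hxy
  have h : hB.emb (x - y) = 0 := by rw [map_sub, hxy, sub_self]
  have h2 : (B (x - y) (x - y)).re = 0 := by rw [← hB.norm_emb_sq, h, norm_zero]; simp
  have h3 : x - y = 0 := by
    by_contra hne
    exact absurd h2 (ne_of_gt (hB.pos _ hne))
  exact sub_eq_zero.mp h3

/-- `emb x = 0 ↔ x = 0`. [cite: KnappVogan1995, Introduction (0.5)] -/
theorem emb_eq_zero_iff (x : V) : hB.emb x = 0 ↔ x = 0 :=
  ⟨fun h => hB.emb_injective (by rw [h, map_zero]), fun h => by rw [h, map_zero]⟩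

/-- **`emb` has dense range** (`V` is dense in `V̂`, and the coordinate map is a surjective isometry). [cite: BorelWallach2000, 0 §2.5] -/
theorem denseRange_emb : DenseRange hB.emb := by
  letI := hB.nacg; letI := hB.ips; haveI := hB.hat_completeSpace
  have h1 : DenseRange ((↑) : V → UniformSpace.Completion V) := UniformSpace.Completion.denseRange_coe
  have h2 : DenseRange (fun z : hB.Hat => hB.hatBasis.repr z) := hB.hatBasis.repr.surjective.denseRange
  exact h2.comp h1 hB.hatBasis.repr.continuous

/-! ## §3 Extension of `B`-bounded operators -/

/-- **The bounded extension to `E` of a `B`-bounded operator `T` on `V`** (Mathlib `LinearMap.extendOfNorm` along the dense `emb`; junk `0`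
when `T` is not `B`-bounded). [cite: BorelWallach2000, 0 §2.5] -/
def extend (T : V →ₗ[ℂ] V) : hB.E →L[ℂ] hB.E :=
  (hB.emb ∘ₗ T).extendOfNorm hB.emb

/-- `extend T (emb x) = emb (T x)` for `B`-bounded `T`. [cite: BorelWallach2000, 0 §2.5] -/
theorem extend_emb {T : V →ₗ[ℂ] V} (hT : ∃ C : ℝ, ∀ x, ‖hB.emb (T x)‖ ≤ C * ‖hB.emb x‖) (x : V) :
    hB.extend T (hB.emb x) = hB.emb (T x) :=
  LinearMap.extendOfNorm_eq hB.denseRange_emb hT x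

/-- `‖extend T z‖ ≤ C ‖z‖` when `‖emb (T x)‖ ≤ C ‖emb x‖` on `V`. [cite: BorelWallach2000, 0 §2.5] -/
theorem norm_extend_apply_le {T : V →ₗ[ℂ] V} (C : ℝ) (hT : ∀ x, ‖hB.emb (T x)‖ ≤ C * ‖hB.emb x‖) (z : hB.E) :
    ‖hB.extend T z‖ ≤ C * ‖z‖ :=
  LinearMap.norm_extendOfNorm_apply_le hB.denseRange_emb C hT z

/-- **Two bounded operators on `E` that agree on `emb V` are equal** (density). [cite: BorelWallach2000, 0 §2.5] -/
theorem eq_of_forall_emb {S S' : hB.E →L[ℂ] hB.E} (h : ∀ x, S (hB.emb x) = S' (hB.emb x)) : S = S' := by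
  have := hB.denseRange_emb.equalizer S.continuous S'.continuous (funext fun x => h x)
  exact ContinuousLinearMap.ext fun z => congrFun this z

/-- **Uniqueness of the extension**: a bounded `S` with `S (emb x) = emb (T x)` IS `extend T`. [cite: BorelWallach2000, 0 §2.5] -/
theorem extend_eq_of_forall_emb {T : V →ₗ[ℂ] V} (hT : ∃ C : ℝ, ∀ x, ‖hB.emb (T x)‖ ≤ C * ‖hB.emb x‖)
    {S : hB.E →L[ℂ] hB.E} (hS : ∀ x, S (hB.emb x) = hB.emb (T x)) : hB.extend T = S :=
  hB.eq_of_forall_emb fun x => by rw [hB.extend_emb hT, hS]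

/-- `extend id = 1`. [cite: BorelWallach2000, 0 §2.5] -/
theorem extend_id : hB.extend LinearMap.id = 1 :=
  hB.extend_eq_of_forall_emb ⟨1, fun x => by simp⟩ fun x => by simp

/-- A `B`-bound may be taken non-negative. [cite: BorelWallach2000, 0 §2.5] -/
theorem exists_bound_nonneg {T : V →ₗ[ℂ] V} (hT : ∃ C : ℝ, ∀ x, ‖hB.emb (T x)‖ ≤ C * ‖hB.emb x‖) :
    ∃ C : ℝ, 0 ≤ C ∧ ∀ x, ‖hB.emb (T x)‖ ≤ C * ‖hB.emb x‖ := by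
  obtain ⟨C, hC⟩ := hT
  exact ⟨max C 0, le_max_right _ _, fun x => (hC x).trans (by gcongr; exact le_max_left _ _)⟩

/-- **Functoriality**: `extend (S ∘ T) = extend S ∘ extend T` for `B`-bounded `S, T`. [cite: BorelWallach2000, 0 §2.5] -/
theorem extend_comp {S T : V →ₗ[ℂ] V} (hS : ∃ C : ℝ, ∀ x, ‖hB.emb (S x)‖ ≤ C * ‖hB.emb x‖)
    (hT : ∃ C : ℝ, ∀ x, ‖hB.emb (T x)‖ ≤ C * ‖hB.emb x‖) : hB.extend (S ∘ₗ T) = hB.extend S ∘L hB.extend T := by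
  obtain ⟨C, hC0, hC⟩ := hB.exists_bound_nonneg hS
  obtain ⟨D, hD0, hD⟩ := hB.exists_bound_nonneg hT
  refine hB.extend_eq_of_forall_emb ⟨C * D, fun x => ?_⟩ fun x => ?_
  · calc ‖hB.emb ((S ∘ₗ T) x)‖ = ‖hB.emb (S (T x))‖ := rfl
      _ ≤ C * ‖hB.emb (T x)‖ := hC _
      _ ≤ C * (D * ‖hB.emb x‖) := by gcongr; exact hD x
      _ = C * D * ‖hB.emb x‖ := by ring
  · rw [ContinuousLinearMap.comp_apply, hB.extend_emb ⟨D, hD⟩, hB.extend_emb ⟨C, hC⟩]; rfl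

/-- The bound of a `B`-ISOMETRIC operator (`B (T x) (T y) = B x y`): `‖emb (T x)‖ = ‖emb x‖`. [cite: BorelWallach2000, 0 §2.5] -/
theorem norm_emb_map_of_isometric {T : V →ₗ[ℂ] V} (hiso : ∀ x y, B (T x) (T y) = B x y) (x : V) :
    ‖hB.emb (T x)‖ = ‖hB.emb x‖ := by
  have h1 := hB.norm_emb_sq (T x)
  rw [hiso, ← hB.norm_emb_sq] at h1
  exact (sq_eq_sq₀ (norm_nonneg _) (norm_nonneg _)).mp h1

/-- A `B`-isometric operator is `B`-bounded with constant `1`. [cite: BorelWallach2000, 0 §2.5] -/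
theorem bound_of_isometric {T : V →ₗ[ℂ] V} (hiso : ∀ x y, B (T x) (T y) = B x y) :
    ∃ C : ℝ, ∀ x, ‖hB.emb (T x)‖ ≤ C * ‖hB.emb x‖ :=
  ⟨1, fun x => by rw [hB.norm_emb_map_of_isometric hiso, one_mul]⟩

/-- The extension of a `B`-isometric operator is an isometry of `E`. [cite: BorelWallach2000, 0 §2.5] -/
theorem norm_extend_of_isometric {T : V →ₗ[ℂ] V} (hiso : ∀ x y, B (T x) (T y) = B x y) (z : hB.E) :
    ‖hB.extend T z‖ = ‖z‖ := by
  have hT := hB.bound_of_isometric hiso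
  refine hB.denseRange_emb.induction_on (p := fun z => ‖hB.extend T z‖ = ‖z‖) z ?_ ?_
  · exact isClosed_eq ((hB.extend T).continuous.norm) continuous_norm
  · intro x
    rw [hB.extend_emb hT, hB.norm_emb_map_of_isometric hiso]

/-- **A `B`-isometric SURJECTIVE operator extends to a unitary of `E`.** [cite: BorelWallach2000, 0 §2.5] -/
theorem extend_mem_unitary {T : V →ₗ[ℂ] V} (hiso : ∀ x y, B (T x) (T y) = B x y) (hsurj : Function.Surjective T) :
    hB.extend T ∈ unitary (hB.E →L[ℂ] hB.E) := by
  have hT := hB.bound_of_isometric hiso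
  have h1 : star (hB.extend T) * hB.extend T = 1 := by
    rw [ContinuousLinearMap.star_eq_adjoint]
    exact (ContinuousLinearMap.norm_map_iff_adjoint_comp_self _).mp (hB.norm_extend_of_isometric hiso)
  -- the range of the isometry `extend T` is closed and contains the dense `emb V`, hence is everything
  have hrange : Function.Surjective (hB.extend T) := by
    have hclosed : IsClosed (Set.range (hB.extend T)) := by
      have hi : Isometry (hB.extend T) :=
        AddMonoidHomClass.isometry_of_norm _ (hB.norm_extend_of_isometric hiso)
      exact hi.isClosedEmbedding.isClosed_range
    have hdense : Dense (Set.range (hB.extend T)) := by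
      refine hB.denseRange_emb.mono ?_
      rintro _ ⟨x, rfl⟩
      obtain ⟨y, rfl⟩ := hsurj x
      exact ⟨hB.emb y, hB.extend_emb hT y⟩
    intro z
    have hz : z ∈ Set.range (hB.extend T) := by
      rw [← hclosed.closure_eq, hdense.closure_eq]; trivial
    exact hz
  refine Unitary.mem_iff.mpr ⟨h1, ContinuousLinearMap.ext fun z => ?_⟩
  obtain ⟨w, rfl⟩ := hrange z
  have := congrArg (fun A : hB.E →L[ℂ] hB.E => hB.extend T (A w)) h1
  simpa [mul_assoc] using this

/-! ## §5 Skew operators read in `E` -/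

/-- A `B`-skew operator `X` (`B (X x) y = − B x (X y)`) is skew after `emb`: `⟪emb (X x), emb y⟫ = −⟪emb x, emb (X y)⟫`.
[cite: KnappVogan1995, Introduction (0.5)] -/
theorem inner_emb_map_eq_neg {X : V →ₗ[ℂ] V} (hX : ∀ x y, B (X x) y = -B x (X y)) (x y : V) :
    ⟪hB.emb (X x), hB.emb y⟫_ℂ = -⟪hB.emb x, hB.emb (X y)⟫_ℂ := by
  rw [hB.inner_emb_emb, hB.inner_emb_emb, hX]

/-- For a `B`-skew `X`: `re ⟪emb (X x), emb x⟫ = 0`. [cite: KnappVogan1995, Introduction (0.5)] -/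
theorem re_inner_emb_map_self {X : V →ₗ[ℂ] V} (hX : ∀ x y, B (X x) y = -B x (X y)) (x : V) :
    (⟪hB.emb (X x), hB.emb x⟫_ℂ).re = 0 := by
  have h1 := hB.inner_emb_map_eq_neg hX x x
  have h2 : ⟪hB.emb x, hB.emb (X x)⟫_ℂ = conj ⟪hB.emb (X x), hB.emb x⟫_ℂ := (inner_conj_symm _ _).symm
  rw [h2] at h1
  have := congrArg Complex.re h1
  simp only [Complex.neg_re, Complex.conj_re] at this
  linarith

end IsPosDefHerm

end Literature.NumberTheory.Automorphic

end
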